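import Summits.BirchSwinnertonDyer.BirchSwinnertonDyer.Theses.ShaPrimaryTransfer
import Literature.NumberTheory.EllipticCurves.XCubeAddDXSharpRankSha
import Literature.NumberTheory.EllipticCurves.XCubeSub82XRankThree

/-!
# BirchSwinnertonDyer / ShaPrimaryTransfer — crux `FiniteShaComponentTransfer` (stmt-BirchSwinnertonDyer-22356):
# the door at 2 is open in the kernel at RANK 6 — `E : y² = x³ − 37443457x` has `rank E(ℚ) = 6` and `Ш(E/ℚ)[2] = 0`

Route `ShaPrimaryTransfer` (D-0145 LINE 2): T = `FiniteShaComponentTransfer` (stmt-22356), whose door at `2` is decided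
curve by curve by complete `2`-descent; companions certify the door in the kernel at ranks `0–3` and `5`. This helper file
(prover seat `bsd-line-spt-p1` g5, `--supports stmt-22356 --as helper`) reaches RANK 6 with the same instrument and no other
input: `E : y² = x³ − 37443457x` (`37443457 = 89·449·937`), `E' : y² = x³ + 149773828x`. The descent via `2`-isogeny is SHARP
on both sides: on `E` the points `(−36, 36714)`, `(7209, 323604)`, `(162089, 65210964)`, `(45913/4, 8323371/8)` give
`α = [−1], [89], [449], [937]`, so `α(E(ℚ)) = {± d : d ∣ 37443457}` (16 classes); on `E'` the points `(98, 121156)`,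
`(1424, 464936)`, `(28736, 5294608)`, `(134928, 49765944)` give `ᾱ = [2], [89], [449], [937]`, so `ᾱ(E'(ℚ))` is all sixteen
positive classes. Hence `2^{rank+2} = #α · #ᾱ ≥ 2⁸` (Silverman–Tate, tree `natCard_range_xSqClass_mul`) and
`rank ≤ ν(37443457) + ν(74886914) − 1 = 6` (X.6.1(b) sharpened, tree `XCubeAddDX.mordellWeilRank_le_add`): **`rank E(ℚ) = 6`**
(`mordellWeilRank_eq_six`); the bound being attained, both `φ`-parts of `Ш` vanish (tree
`forall_mem_sha_two_smul_eq_zero_xD_of_rank_eq`, X.4.7): **`Ш(E/ℚ)[2] = 0`** (`forall_mem_sha_two_smul_eq_zero`), `t_2(E) = 0`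
(`door_at_two_rank_six`), `corank_{ℤ_2} Sel_{2^∞}(E/ℚ) = 6` (`selmerCorank_two_eq_six`), O for `E` (`oneFiniteShaComponent_E`);
T BY NAME: `selmerCorank_eq_six_of_transfer` (granting T, `t_q(E) = 0`, `corank Sel_{q^∞}(E) = 6` at every `q`).

Everything is UNCONDITIONAL (standard axioms; no named fact, no `L`-function, no local insolubility argument — the curve was
selected by a seconds-long search among `y² = x³ − p₁p₂p₃x` for rational points filling the a-priori Selmer bounds). In this tree
exact ranks had been certified up to `4` (`CongruentNumberCurve29274Selmer`; `rankFiveWitness`: `5 ≤ rank`). Nothing here proves T,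
O or BSD; T is conjecture-grade at rank ≥ 2 and its CONCLUSION (all `t_q = 0`) is certified for no curve of rank ≥ 2. (`E` has
CM by `ℤ[i]`.) References: J. H. Silverman, *AEC* 2nd ed., X.4.7, X.4.9, X.6.1; J. H. Silverman, J. Tate, *Rational Points on
Elliptic Curves*, §3.5–3.6; R. Greenberg, LNM 1716 (1999), §1.
-/

-- D-0017: single-problem summit, so `Summit.BirchSwinnertonDyer.BirchSwinnertonDyer.…` repeats a namespace BY DESIGN.
set_option linter.dupNamespace false

noncomputable section

namespace Summit.BirchSwinnertonDyer.BirchSwinnertonDyer.Theorems.ShaPrimaryTransferKernelRankSix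

open scoped Classical
open Literature.NumberTheory.EllipticCurves Literature.NumberTheory.EllipticCurves.XCubeAddDX
open WeierstrassCurve WeierstrassCurve.Affine
open Summit.BirchSwinnertonDyer.BirchSwinnertonDyer.Theses.ShaPrimaryTransfer (FiniteShaComponentTransfer)

/-! ## §0 Bookkeeping (`n = 37443457 = 89·449·937`, `4n = 149773828`) -/

/-- `b(a² − 4b) ≠ 0` for `(a, b) = (0, −37443457)`. [folklore] -/
private theorem hab6 : (-37443457 : ℤ) * ((0 : ℤ) ^ 2 - 4 * (-37443457)) ≠ 0 := by norm_num

/-- The tree's literal `E_{0,−n}` is `⟨0, 0, 0, −n, 0⟩`. [folklore] -/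
private theorem lit_E : (⟨0, ((0 : ℤ) : ℚ), 0, ((-37443457 : ℤ) : ℚ), 0⟩ : WeierstrassCurve ℚ) = ⟨0, 0, 0, -37443457, 0⟩ := by
  ext <;> push_cast <;> ring

/-- The literal `⟨0, 0, 0, ((−n : ℤ) : ℚ), 0⟩` is `⟨0, 0, 0, −n, 0⟩`. [folklore] -/
private theorem lit_E₀ : (⟨0, 0, 0, ((-37443457 : ℤ) : ℚ), 0⟩ : WeierstrassCurve ℚ) = ⟨0, 0, 0, -37443457, 0⟩ := by
  ext <;> push_cast <;> ring

/-- The tree's literal `E'_{0,−n} = E_{0, 4n}` is `⟨0, 0, 0, 149773828, 0⟩`. [folklore] -/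
private theorem lit_E' :
    (⟨0, ((-2 * 0 : ℤ) : ℚ), 0, (((0 : ℤ) ^ 2 - 4 * (-37443457) : ℤ) : ℚ), 0⟩ : WeierstrassCurve ℚ) =
      ⟨0, 0, 0, 149773828, 0⟩ := by
  ext <;> push_cast <;> ring

/-- `E : y² = x³ − 37443457x` is an elliptic curve. [folklore] -/
theorem isElliptic_E : (⟨0, 0, 0, -37443457, 0⟩ : WeierstrassCurve ℚ).IsElliptic := by
  rw [← lit_E]; exact isElliptic_mk_of_ne_zero (F := ℚ) hab6

/-- `E' : y² = x³ + 149773828x` is an elliptic curve. [folklore] -/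
theorem isElliptic_E' : (⟨0, 0, 0, 149773828, 0⟩ : WeierstrassCurve ℚ).IsElliptic := by
  rw [← lit_E']; exact isElliptic_mk_of_ne_zero (F := ℚ) (twoIsogenyCodomain_ne_zero hab6)

/-- Squarefree integers with the same class in `ℚ*/ℚ*²` are equal. [folklore] -/
private theorem eq_of_sqClass_intCast_eq {d₁ d₂ : ℤ} (h₁ : Squarefree d₁) (h₂ : Squarefree d₂)
    (he : sqClass (d₁ : ℚ) = sqClass (d₂ : ℚ)) : d₁ = d₂ := by
  have h0₁ : (d₁ : ℚ) ≠ 0 := by exact_mod_cast h₁.ne_zero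
  have h0₂ : (d₂ : ℚ) ≠ 0 := by exact_mod_cast h₂.ne_zero
  have h1 : sqClass ((d₁ : ℚ) * d₂) = 1 := by rw [sqClass_mul h0₁ h0₂, he, SqUnits.mul_self]
  obtain ⟨u, hu⟩ := (sqClass_eq_one_iff (mul_ne_zero h0₁ h0₂)).mp h1
  obtain ⟨m, hm⟩ : IsSquare (d₁ * d₂) := by
    rw [← Rat.isSquare_intCast_iff]
    exact ⟨u, by push_cast; rw [hu, pow_two]⟩
  exact eq_of_squarefree_of_mul_eq_sq h₁ h₂ (m := m) (by rw [hm, pow_two])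

/-- Squarefreeness of an integer from the factorisation of its absolute value. [folklore] -/
private theorem squarefree_int_of_natAbs {d : ℤ} {n : ℕ} (h : d.natAbs = n) (hn : n ≠ 0)
    (hnd : n.primeFactorsList.Nodup) : Squarefree d :=
  Int.squarefree_natAbs.mp (h ▸ (Nat.squarefree_iff_nodup_primeFactorsList hn).mpr hnd)

/-- A rational solution of `y² = x³ + bx` with `x ≠ 0` puts `[x]` into `α(E_{0,b}(ℚ))`. [folklore] -/
private theorem sqClass_mem_range_of_eq {b x y : ℚ} [(⟨0, 0, 0, b, 0⟩ : WeierstrassCurve ℚ).IsElliptic]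
    (hy : y ^ 2 = x ^ 3 + b * x) (hx : x ≠ 0) : sqClass x ∈ Set.range (⟨0, 0, 0, b, 0⟩ : WeierstrassCurve ℚ).xSqClass := by
  have hns : (⟨0, 0, 0, b, 0⟩ : WeierstrassCurve ℚ).toAffine.Nonsingular x y := by
    refine Affine.equation_iff_nonsingular.mp ?_
    rw [Affine.equation_iff]
    show y ^ 2 + 0 * x * y + 0 * y = x ^ 3 + 0 * x ^ 2 + b * x + 0
    linear_combination hy
  exact ⟨.some x y hns, xSqClass_some_of_ne_zero _ hx⟩

/-- `[x t²] = [x]` in `ℚ*/ℚ*²`. [folklore] -/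
private theorem sqClass_mul_sq' {x t : ℚ} (hx : x ≠ 0) (ht : t ≠ 0) : sqClass (x * t ^ 2) = sqClass x := by
  rw [sqClass_mul hx (pow_ne_zero 2 ht), sqClass_sq, mul_one]

/-- The sixteen squarefree divisors (up to sign) built from `89, 449, 937` (and `2`) are squarefree. [folklore] -/
private theorem squarefree_of_mem {d : ℤ}
    (hd : d ∈ ({1, 2, 89, 178, 449, 898, 937, 1874, 39961, 79922, 83393, 166786, 420713, 841426, 37443457, 74886914} :
      Finset ℤ)) : Squarefree d := by
  simp only [Finset.mem_insert, Finset.mem_singleton] at hd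
  rcases hd with rfl | rfl | rfl | rfl | rfl | rfl | rfl | rfl | rfl | rfl | rfl | rfl | rfl | rfl | rfl | rfl
  · exact squarefree_int_of_natAbs (n := 1) rfl one_ne_zero (by simp)
  · exact squarefree_int_of_natAbs (n := 2) rfl two_ne_zero (by simp)
  · exact squarefree_int_of_natAbs (n := 89) rfl (by norm_num) (by simp)
  · exact squarefree_int_of_natAbs (n := 178) rfl (by norm_num) (by simp)
  · exact squarefree_int_of_natAbs (n := 449) rfl (by norm_num) (by simp)
  · exact squarefree_int_of_natAbs (n := 898) rfl (by norm_num) (by simp)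
  · exact squarefree_int_of_natAbs (n := 937) rfl (by norm_num) (by simp)
  · exact squarefree_int_of_natAbs (n := 1874) rfl (by norm_num) (by simp)
  · exact squarefree_int_of_natAbs (n := 39961) rfl (by norm_num) (by simp)
  · exact squarefree_int_of_natAbs (n := 79922) rfl (by norm_num) (by simp)
  · exact squarefree_int_of_natAbs (n := 83393) rfl (by norm_num) (by simp)
  · exact squarefree_int_of_natAbs (n := 166786) rfl (by norm_num) (by simp)
  · exact squarefree_int_of_natAbs (n := 420713) rfl (by norm_num) (by simp)
  · exact squarefree_int_of_natAbs (n := 841426) rfl (by norm_num) (by simp)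
  · exact squarefree_int_of_natAbs (n := 37443457) rfl (by norm_num) (by simp)
  · exact squarefree_int_of_natAbs (n := 74886914) rfl (by norm_num) (by simp)

/-- `−d` is squarefree with `d`. [folklore] -/
private theorem squarefree_neg_iff {d : ℤ} : Squarefree (-d) ↔ Squarefree d := by
  rw [← Int.squarefree_natAbs, Int.natAbs_neg, Int.squarefree_natAbs]

/-! ## §1 `#α(E(ℚ)) ≥ 16`: the points `(−36, 36714)`, `(7209, 323604)`, `(162089, 65210964)`, `(45913/4, 8323371/8)` -/

/-- **`#α(E(ℚ)) ≥ 16` for `E : y² = x³ − 37443457x`**: the rational points `(−36, 36714)`, `(7209, 323604)` (`7209 = 89·9²`),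
`(162089, 65210964)` (`= 449·19²`), `(45913/4, 8323371/8)` (`45913/4 = 937·(7/2)²`) have `α = [−1], [89], [449], [937]`;
`α(E(ℚ))` is a group, so it contains all sixteen classes `{± d : d ∣ 37443457}`. UNCONDITIONAL.
[cite: SilvermanTate2015, §3.5–3.6 (α(x,y) = x mod ℚ*²; 2^r = #α(Γ)·#ᾱ(Γ̄)/4)] -/
theorem natCard_range_xSqClass_E_ge :
    (Set.range (⟨0, 0, 0, -37443457, 0⟩ : WeierstrassCurve ℚ).xSqClass).Finite ∧
      16 ≤ Nat.card (Set.range (⟨0, 0, 0, -37443457, 0⟩ : WeierstrassCurve ℚ).xSqClass) := by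
  haveI := isElliptic_E
  set W := (⟨0, 0, 0, -37443457, 0⟩ : WeierstrassCurve ℚ) with hW
  have hfin : (Set.range W.xSqClass).Finite := by
    have h := (natCard_range_xSqClass_le (a := 0) (b := -37443457) hab6).1
    rw [lit_E] at h
    exact h
  refine ⟨hfin, ?_⟩
  have mul : ∀ {x y : ℚ}, x ≠ 0 → y ≠ 0 → sqClass x ∈ Set.range W.xSqClass → sqClass y ∈ Set.range W.xSqClass →
      sqClass (x * y) ∈ Set.range W.xSqClass := by
    intro x y hx hy h₁ h₂
    rw [sqClass_mul hx hy]
    exact mul_mem_range_xSqClass W h₁ h₂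
  have g0 : sqClass (1 : ℚ) ∈ Set.range W.xSqClass :=
    ⟨0, by rw [xSqClass_zero]; exact ((sqClass_eq_one_iff one_ne_zero).mpr ⟨1, by norm_num⟩).symm⟩
  have gm1 : sqClass (-1 : ℚ) ∈ Set.range W.xSqClass := by
    have h := sqClass_mem_range_of_eq (b := -37443457) (x := -36) (y := 36714) (by norm_num) (by norm_num)
    rwa [show (-36 : ℚ) = -1 * 6 ^ 2 by norm_num, sqClass_mul_sq' (by norm_num) (by norm_num)] at h
  have g89 : sqClass (89 : ℚ) ∈ Set.range W.xSqClass := by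
    have h := sqClass_mem_range_of_eq (b := -37443457) (x := 7209) (y := 323604) (by norm_num) (by norm_num)
    rwa [show (7209 : ℚ) = 89 * 9 ^ 2 by norm_num, sqClass_mul_sq' (by norm_num) (by norm_num)] at h
  have g449 : sqClass (449 : ℚ) ∈ Set.range W.xSqClass := by
    have h := sqClass_mem_range_of_eq (b := -37443457) (x := 162089) (y := 65210964) (by norm_num) (by norm_num)
    rwa [show (162089 : ℚ) = 449 * 19 ^ 2 by norm_num, sqClass_mul_sq' (by norm_num) (by norm_num)] at h
  have g937 : sqClass (937 : ℚ) ∈ Set.range W.xSqClass := by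
    have h := sqClass_mem_range_of_eq (b := -37443457) (x := 45913 / 4) (y := 8323371 / 8) (by norm_num) (by norm_num)
    rwa [show (45913 / 4 : ℚ) = 937 * (7 / 2) ^ 2 by norm_num, sqClass_mul_sq' (by norm_num) (by norm_num)] at h
  have g39961 : sqClass (39961 : ℚ) ∈ Set.range W.xSqClass := by
    have h := mul (by norm_num) (by norm_num) g89 g449; norm_num at h; exact h
  have g83393 : sqClass (83393 : ℚ) ∈ Set.range W.xSqClass := by
    have h := mul (by norm_num) (by norm_num) g89 g937; norm_num at h; exact h
  have g420713 : sqClass (420713 : ℚ) ∈ Set.range W.xSqClass := by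
    have h := mul (by norm_num) (by norm_num) g449 g937; norm_num at h; exact h
  have gn : sqClass (37443457 : ℚ) ∈ Set.range W.xSqClass := by
    have h := mul (by norm_num) (by norm_num) g39961 g937; norm_num at h; exact h
  have neg : ∀ {x : ℚ}, x ≠ 0 → sqClass x ∈ Set.range W.xSqClass → sqClass (-x) ∈ Set.range W.xSqClass := by
    intro x hx h
    have h' := mul (by norm_num) hx gm1 h
    rwa [neg_one_mul] at h'
  set C : Finset ℤ := {1, -1, 89, -89, 449, -449, 937, -937, 39961, -39961, 83393, -83393, 420713, -420713,
    37443457, -37443457} with hC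
  have hsqf : ∀ d ∈ C, Squarefree d := by
    intro d hd
    simp only [hC, Finset.mem_insert, Finset.mem_singleton] at hd
    rcases hd with rfl | rfl | rfl | rfl | rfl | rfl | rfl | rfl | rfl | rfl | rfl | rfl | rfl | rfl | rfl | rfl
    · exact squarefree_of_mem (by simp)
    · exact squarefree_neg_iff.mpr (squarefree_of_mem (by simp))
    · exact squarefree_of_mem (by simp)
    · exact squarefree_neg_iff.mpr (squarefree_of_mem (by simp))
    · exact squarefree_of_mem (by simp)
    · exact squarefree_neg_iff.mpr (squarefree_of_mem (by simp))
    · exact squarefree_of_mem (by simp)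
    · exact squarefree_neg_iff.mpr (squarefree_of_mem (by simp))
    · exact squarefree_of_mem (by simp)
    · exact squarefree_neg_iff.mpr (squarefree_of_mem (by simp))
    · exact squarefree_of_mem (by simp)
    · exact squarefree_neg_iff.mpr (squarefree_of_mem (by simp))
    · exact squarefree_of_mem (by simp)
    · exact squarefree_neg_iff.mpr (squarefree_of_mem (by simp))
    · exact squarefree_of_mem (by simp)
    · exact squarefree_neg_iff.mpr (squarefree_of_mem (by simp))
  have hsub : (↑(C.image fun d : ℤ => sqClass (d : ℚ)) : Set (SqUnits ℚ)) ⊆ Set.range W.xSqClass := by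
    intro c hc
    obtain ⟨d, hd, rfl⟩ := Finset.mem_image.mp (Finset.mem_coe.mp hc)
    simp only [hC, Finset.mem_insert, Finset.mem_singleton] at hd
    rcases hd with rfl | rfl | rfl | rfl | rfl | rfl | rfl | rfl | rfl | rfl | rfl | rfl | rfl | rfl | rfl | rfl <;>
      push_cast
    · exact g0
    · exact gm1
    · exact g89
    · exact neg (by norm_num) g89
    · exact g449
    · exact neg (by norm_num) g449
    · exact g937
    · exact neg (by norm_num) g937
    · exact g39961
    · exact neg (by norm_num) g39961
    · exact g83393
    · exact neg (by norm_num) g83393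
    · exact g420713
    · exact neg (by norm_num) g420713
    · exact gn
    · exact neg (by norm_num) gn
  have hcard : (C.image fun d : ℤ => sqClass (d : ℚ)).card = 16 := by
    rw [Finset.card_image_of_injOn (fun d₁ h₁ d₂ h₂ he => eq_of_sqClass_intCast_eq (hsqf d₁ h₁) (hsqf d₂ h₂) he)]
    rfl
  calc 16 = (↑(C.image fun d : ℤ => sqClass (d : ℚ)) : Set (SqUnits ℚ)).ncard := by rw [Set.ncard_coe_finset, hcard]
    _ ≤ (Set.range W.xSqClass).ncard := Set.ncard_le_ncard hsub hfin
    _ = Nat.card (Set.range W.xSqClass) := (Nat.card_coe_set_eq _).symm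

/-! ## §2 `#ᾱ(E'(ℚ)) ≥ 16`: the points `(98, 121156)`, `(1424, 464936)`, `(28736, 5294608)`, `(134928, 49765944)` -/

/-- **`#ᾱ(E'(ℚ)) ≥ 16` for `E' : y² = x³ + 149773828x`**: the points `(98, 121156)` (`98 = 2·7²`), `(1424, 464936)`
(`= 89·4²`), `(28736, 5294608)` (`= 449·8²`), `(134928, 49765944)` (`= 937·12²`) give `ᾱ = [2], [89], [449], [937]`, whence
all sixteen positive classes `[d]`, `d ∣ 2·37443457` squarefree. UNCONDITIONAL. [cite: SilvermanTate2015, §3.5–3.6 (ᾱ on Γ̄)] -/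
theorem natCard_range_xSqClass_E'_ge :
    (Set.range (⟨0, 0, 0, 149773828, 0⟩ : WeierstrassCurve ℚ).xSqClass).Finite ∧
      16 ≤ Nat.card (Set.range (⟨0, 0, 0, 149773828, 0⟩ : WeierstrassCurve ℚ).xSqClass) := by
  haveI := isElliptic_E'
  set W := (⟨0, 0, 0, 149773828, 0⟩ : WeierstrassCurve ℚ) with hW
  have hfin : (Set.range W.xSqClass).Finite := by
    have h := (natCard_range_xSqClass_le (a := -2 * 0) (b := (0 : ℤ) ^ 2 - 4 * (-37443457))
      (twoIsogenyCodomain_ne_zero hab6)).1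
    rw [lit_E'] at h
    exact h
  refine ⟨hfin, ?_⟩
  have mul : ∀ {x y : ℚ}, x ≠ 0 → y ≠ 0 → sqClass x ∈ Set.range W.xSqClass → sqClass y ∈ Set.range W.xSqClass →
      sqClass (x * y) ∈ Set.range W.xSqClass := by
    intro x y hx hy h₁ h₂
    rw [sqClass_mul hx hy]
    exact mul_mem_range_xSqClass W h₁ h₂
  have g0 : sqClass (1 : ℚ) ∈ Set.range W.xSqClass :=
    ⟨0, by rw [xSqClass_zero]; exact ((sqClass_eq_one_iff one_ne_zero).mpr ⟨1, by norm_num⟩).symm⟩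
  have g2 : sqClass (2 : ℚ) ∈ Set.range W.xSqClass := by
    have h := sqClass_mem_range_of_eq (b := 149773828) (x := 98) (y := 121156) (by norm_num) (by norm_num)
    rwa [show (98 : ℚ) = 2 * 7 ^ 2 by norm_num, sqClass_mul_sq' (by norm_num) (by norm_num)] at h
  have g89 : sqClass (89 : ℚ) ∈ Set.range W.xSqClass := by
    have h := sqClass_mem_range_of_eq (b := 149773828) (x := 1424) (y := 464936) (by norm_num) (by norm_num)
    rwa [show (1424 : ℚ) = 89 * 4 ^ 2 by norm_num, sqClass_mul_sq' (by norm_num) (by norm_num)] at h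
  have g449 : sqClass (449 : ℚ) ∈ Set.range W.xSqClass := by
    have h := sqClass_mem_range_of_eq (b := 149773828) (x := 28736) (y := 5294608) (by norm_num) (by norm_num)
    rwa [show (28736 : ℚ) = 449 * 8 ^ 2 by norm_num, sqClass_mul_sq' (by norm_num) (by norm_num)] at h
  have g937 : sqClass (937 : ℚ) ∈ Set.range W.xSqClass := by
    have h := sqClass_mem_range_of_eq (b := 149773828) (x := 134928) (y := 49765944) (by norm_num) (by norm_num)
    rwa [show (134928 : ℚ) = 937 * 12 ^ 2 by norm_num, sqClass_mul_sq' (by norm_num) (by norm_num)] at h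
  have g178 : sqClass (178 : ℚ) ∈ Set.range W.xSqClass := by
    have h := mul (by norm_num) (by norm_num) g2 g89; norm_num at h; exact h
  have g898 : sqClass (898 : ℚ) ∈ Set.range W.xSqClass := by
    have h := mul (by norm_num) (by norm_num) g2 g449; norm_num at h; exact h
  have g1874 : sqClass (1874 : ℚ) ∈ Set.range W.xSqClass := by
    have h := mul (by norm_num) (by norm_num) g2 g937; norm_num at h; exact h
  have g39961 : sqClass (39961 : ℚ) ∈ Set.range W.xSqClass := by
    have h := mul (by norm_num) (by norm_num) g89 g449; norm_num at h; exact h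
  have g83393 : sqClass (83393 : ℚ) ∈ Set.range W.xSqClass := by
    have h := mul (by norm_num) (by norm_num) g89 g937; norm_num at h; exact h
  have g420713 : sqClass (420713 : ℚ) ∈ Set.range W.xSqClass := by
    have h := mul (by norm_num) (by norm_num) g449 g937; norm_num at h; exact h
  have g79922 : sqClass (79922 : ℚ) ∈ Set.range W.xSqClass := by
    have h := mul (by norm_num) (by norm_num) g2 g39961; norm_num at h; exact h
  have g166786 : sqClass (166786 : ℚ) ∈ Set.range W.xSqClass := by
    have h := mul (by norm_num) (by norm_num) g2 g83393; norm_num at h; exact h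
  have g841426 : sqClass (841426 : ℚ) ∈ Set.range W.xSqClass := by
    have h := mul (by norm_num) (by norm_num) g2 g420713; norm_num at h; exact h
  have gn : sqClass (37443457 : ℚ) ∈ Set.range W.xSqClass := by
    have h := mul (by norm_num) (by norm_num) g39961 g937; norm_num at h; exact h
  have g2n : sqClass (74886914 : ℚ) ∈ Set.range W.xSqClass := by
    have h := mul (by norm_num) (by norm_num) g2 gn; norm_num at h; exact h
  set C : Finset ℤ := {1, 2, 89, 178, 449, 898, 937, 1874, 39961, 79922, 83393, 166786, 420713, 841426, 37443457,
    74886914} with hC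
  have hsub : (↑(C.image fun d : ℤ => sqClass (d : ℚ)) : Set (SqUnits ℚ)) ⊆ Set.range W.xSqClass := by
    intro c hc
    obtain ⟨d, hd, rfl⟩ := Finset.mem_image.mp (Finset.mem_coe.mp hc)
    simp only [hC, Finset.mem_insert, Finset.mem_singleton] at hd
    rcases hd with rfl | rfl | rfl | rfl | rfl | rfl | rfl | rfl | rfl | rfl | rfl | rfl | rfl | rfl | rfl | rfl <;>
      push_cast
    · exact g0
    · exact g2
    · exact g89
    · exact g178
    · exact g449
    · exact g898
    · exact g937
    · exact g1874
    · exact g39961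
    · exact g79922
    · exact g83393
    · exact g166786
    · exact g420713
    · exact g841426
    · exact gn
    · exact g2n
  have hcard : (C.image fun d : ℤ => sqClass (d : ℚ)).card = 16 := by
    rw [Finset.card_image_of_injOn (fun d₁ h₁ d₂ h₂ he =>
      eq_of_sqClass_intCast_eq (squarefree_of_mem h₁) (squarefree_of_mem h₂) he)]
    rfl
  calc 16 = (↑(C.image fun d : ℤ => sqClass (d : ℚ)) : Set (SqUnits ℚ)).ncard := by rw [Set.ncard_coe_finset, hcard]
    _ ≤ (Set.range W.xSqClass).ncard := Set.ncard_le_ncard hsub hfin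
    _ = Nat.card (Set.range W.xSqClass) := (Nat.card_coe_set_eq _).symm

/-! ## §3 `rank E(ℚ) = 6`, `Ш(E/ℚ)[2] = 0`, `t_2(E) = 0`, `corank Sel_{2^∞}(E/ℚ) = 6` -/

/-- `ν(37443457) = 3` and `ν(74886914) = 4` (`37443457 = 89·449·937`): the bound `ν(D) + ν(2D) − 1` of the descent is `6`. [folklore] -/
theorem card_primeFactors_n :
    (-37443457 : ℤ).natAbs.primeFactors.card = 3 ∧ (2 * (-37443457 : ℤ)).natAbs.primeFactors.card = 4 := by
  rw [show (-37443457 : ℤ).natAbs = 37443457 from rfl, show (2 * (-37443457 : ℤ)).natAbs = 74886914 from rfl]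
  constructor <;> simp [Nat.primeFactors]

/-- **`rank E(ℚ) = 6` for `E : y² = x³ − 37443457x`**, UNCONDITIONALLY: `2^{rank + 2} = #α(E(ℚ)) · #ᾱ(E'(ℚ)) ≥ 16 · 16 = 2⁸`
(Silverman–Tate, tree `natCard_range_xSqClass_mul`) and `rank ≤ ν(n) + ν(2n) − 1 = 6` (Silverman X.6.1(b) sharpened, tree
`XCubeAddDX.mordellWeilRank_le_add`). [cite: SilvermanTate2015, §3.6 (2^r = #α(Γ)·#ᾱ(Γ̄)/4)] [cite: SilvermanAEC2009, Prop. X.6.1(b)] -/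
theorem mordellWeilRank_eq_six : (⟨0, 0, 0, -37443457, 0⟩ : WeierstrassCurve ℚ).mordellWeilRank = 6 := by
  haveI hE := isElliptic_mk_of_ne_zero (F := ℚ) hab6
  have key := natCard_range_xSqClass_mul (⟨0, ((0 : ℤ) : ℚ), 0, ((-37443457 : ℤ) : ℚ), 0⟩ : WeierstrassCurve ℚ)
  rw [twoIsogenyCodomain_mk_intCast 0 (-37443457 : ℤ), lit_E', lit_E] at key
  obtain ⟨-, h16⟩ := natCard_range_xSqClass_E_ge
  obtain ⟨-, h16'⟩ := natCard_range_xSqClass_E'_ge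
  have h256 : 2 ^ 8 ≤ 2 ^ ((⟨0, 0, 0, -37443457, 0⟩ : WeierstrassCurve ℚ).mordellWeilRank + 2) := by
    rw [← key]
    exact le_trans (by norm_num) (Nat.mul_le_mul h16 h16')
  have hge : 8 ≤ (⟨0, 0, 0, -37443457, 0⟩ : WeierstrassCurve ℚ).mordellWeilRank + 2 :=
    (Nat.pow_le_pow_iff_right Nat.one_lt_two).mp h256
  have hle := XCubeAddDX.mordellWeilRank_le_add (D := -37443457) (by norm_num)
  rw [card_primeFactors_n.1, card_primeFactors_n.2, lit_E₀] at hle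
  omega

/-- `rank E(ℚ) = ν(D) + ν(2D) − 1` for `D = −37443457`: the descent bound is attained. [cite: SilvermanAEC2009, Prop. X.6.1(b)] -/
theorem mordellWeilRank_eq_bound :
    (⟨0, 0, 0, ((-37443457 : ℤ) : ℚ), 0⟩ : WeierstrassCurve ℚ).mordellWeilRank =
      (-37443457 : ℤ).natAbs.primeFactors.card + (2 * (-37443457 : ℤ)).natAbs.primeFactors.card - 1 := by
  rw [lit_E₀, mordellWeilRank_eq_six, card_primeFactors_n.1, card_primeFactors_n.2]

/-- **`Ш(E/ℚ)[2] = 0` for `E : y² = x³ − 37443457x`**, UNCONDITIONALLY (sharp descent, tree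
`forall_mem_sha_two_smul_eq_zero_xD_of_rank_eq`, Silverman X.4.7). [cite: SilvermanAEC2009, Prop. X.4.7 and Thm. X.4.2(a)] -/
theorem forall_mem_sha_two_smul_eq_zero :
    ∀ c ∈ (⟨0, 0, 0, -37443457, 0⟩ : WeierstrassCurve ℚ).sha, 2 • c = 0 → c = 0 := by
  have h := forall_mem_sha_two_smul_eq_zero_xD_of_rank_eq (D := -37443457) (by norm_num) mordellWeilRank_eq_bound
  rwa [lit_E₀] at h

/-- **The door at 2 at rank 6: `rank E(ℚ) = 6` and `t_2(E) = corank_{ℤ_2} Ш(E/ℚ)[2^∞] = 0`** for `E : y² = x³ − 37443457x`.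
UNCONDITIONAL. [cite: SilvermanAEC2009, Prop. X.6.1(b) with Prop. X.4.7] [cite: Greenberg1999LNM, §1] -/
theorem door_at_two_rank_six :
    (⟨0, 0, 0, -37443457, 0⟩ : WeierstrassCurve ℚ).mordellWeilRank = 6 ∧
      (⟨0, 0, 0, -37443457, 0⟩ : WeierstrassCurve ℚ).shaCorank 2 = 0 := by
  have h := shaCorank_two_xD_of_rank_eq (D := -37443457) (by norm_num) mordellWeilRank_eq_bound
  rw [lit_E₀] at h
  exact ⟨mordellWeilRank_eq_six, h⟩

/-- **`corank_{ℤ_2} Sel_{2^∞}(E/ℚ) = 6 = rank E(ℚ)`** for `E : y² = x³ − 37443457x`: T's hypothesis in Selmer coordinates,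
kernel-certified at rank 6. UNCONDITIONAL. [cite: Greenberg1999LNM, §1 pp. 54–57] -/
theorem selmerCorank_two_eq_six : (⟨0, 0, 0, -37443457, 0⟩ : WeierstrassCurve ℚ).selmerCorank 2 = 6 := by
  have h := selmerCorank_two_xD_of_rank_eq (D := -37443457) (by norm_num) mordellWeilRank_eq_bound
  rw [lit_E₀, mordellWeilRank_eq_six] at h
  exact h

/-- **O holds for `E : y² = x³ − 37443457x`** (rank 6), witness `p₀ = 2`. UNCONDITIONAL. [cite: Greenberg1999LNM, §1] -/
theorem oneFiniteShaComponent_E :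
    ∃ (q : ℕ) (_ : Fact q.Prime), (⟨0, 0, 0, -37443457, 0⟩ : WeierstrassCurve ℚ).shaCorank q = 0 :=
  ⟨2, ⟨Nat.prime_two⟩, door_at_two_rank_six.2⟩

/-- **T at the rank-6 door** (the crux BY NAME): granting T, `t_q(E) = 0` and `corank_{ℤ_q} Sel_{q^∞}(E/ℚ) = 6` at EVERY
prime `q` — unconditional at `q = 2`, certified for no odd `q`. [cite: Greenberg1999LNM, §1 pp. 54–57] -/
theorem selmerCorank_eq_six_of_transfer (hT : FiniteShaComponentTransfer) (q : ℕ) [Fact q.Prime] :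
    (⟨0, 0, 0, -37443457, 0⟩ : WeierstrassCurve ℚ).shaCorank q = 0 ∧
      (⟨0, 0, 0, -37443457, 0⟩ : WeierstrassCurve ℚ).selmerCorank q = 6 := by
  haveI := isElliptic_E
  haveI : Fact (Nat.Prime 2) := ⟨Nat.prime_two⟩
  have h0 : (⟨0, 0, 0, -37443457, 0⟩ : WeierstrassCurve ℚ).shaCorank q = 0 := hT _ 2 q door_at_two_rank_six.2
  refine ⟨h0, ?_⟩
  rw [(⟨0, 0, 0, -37443457, 0⟩ : WeierstrassCurve ℚ).selmerCorank_eq_mordellWeilRank_add_holds q, mordellWeilRank_eq_six, h0]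

/-- **T's hypothesis is kernel-certified at rank 6**: an elliptic `E/ℚ` with `rank = 6`, `corank Sel_{2^∞}(E) = 6`,
`t_2(E) = 0`. UNCONDITIONAL. [cite: Greenberg1999LNM, §1] -/
theorem exists_transfer_hypothesis_rank_six :
    ∃ W : WeierstrassCurve ℚ, W.IsElliptic ∧ W.mordellWeilRank = 6 ∧ W.selmerCorank 2 = 6 ∧ W.shaCorank 2 = 0 :=
  ⟨_, isElliptic_E, mordellWeilRank_eq_six, selmerCorank_two_eq_six, door_at_two_rank_six.2⟩

end Summit.BirchSwinnertonDyer.BirchSwinnertonDyer.Theorems.ShaPrimaryTransferKernelRankSix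

end
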